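import Summits.HodgeConjecture.HodgeConjecture.Theorems.R90S5HsphOfFlathAdmissible     -- ★ S5 road γ under «AFA»: `hsph_of_automorphicFlathAdmissible`, `xiString_*_of_automorphicFlathAdmissible` (every hermitian `H`)
import Summits.HodgeConjecture.HodgeConjecture.Theorems.R90S9FlathOfAnisotropic         -- ★ `automorphicFlathAdmissible_of_anisotropic` (p861871): «AFA» HOLDS at an anisotropic `H`
import HarnessLib

/-!
# R90-TF · S9 «InnerForm-13.3.6 (c)» — THE E.V.P. STRING «`t(P) = t(Π(ξ))`» FOR THE DEFINITE INNER FORM, UNCONDITIONALLY: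
# at an ANISOTROPIC hermitian `H`, every discrete `P` of `U(H)` in the ξ-envelope has the E1 eigenvalue package of the record ξ-string off a finite set
# (p06's pin `hstring` of the (AE-ⅱ) cut ENGINE, discharged; S5's ★ road γ under «AFA» + ★ «AFA» at anisotropic `H`)

Cell `hodgecm-mathlib`, crux H413 (`stmt-HodgeConjecture-24833`, lane `--supports … --as helper`), route of record `HCCMUnconditional` (count-neutral).  Programme R90-TF,
section S9 (base `R90-IF`); seat R90-IF-p05 (g0), default offer (a) after deal p05 (R90 bus 2026-09-04T16:3xZ) — serves R90-IF-p06 (g0)'s (AE-ⅱ) ENGINE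
`definiteAeRigidityAt_of_parts`, pin `hstring : ‹(AE)› → ‹E1 STRING›` («S1∕AFA pending»), and R90-IF-p01 (g0)'s §14.6 datum field `evpRep`.  THEOREMS ONLY (no `def`, no instance,
no notation, no named fact, no `sorry`); never imports a `Cruxes/…/Lines` module; namespace `Summit.HodgeConjecture.HodgeConjecture.R90.S9`.
HONEST LABEL: HC_CM is proved only modulo the 7 printed citations (2 remaining named inputs: hLiu418 = stmt-HodgeConjecture-24832, h413 = stmt-HodgeConjecture-24833)
— until rung 0 closes.  E1-currency book-keeping for the definite inner form; ★ helper ≠ leaf; no leaf moves.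

## CONTENTS (all at an ANISOTROPIC `H ∈ M₃(L)` — (B4)'s guard `hanis` — where «AFA» is ★ `automorphicFlathAdmissible_of_anisotropic`)
* §1 `hsph_of_anisotropic` — every discrete `P` of `U(H)` has, at all but finitely many finite places, a `U(H)(𝒪_v)`-SPHERICAL admissible unitarizable constituent (the binder
  `hsph` of ★ `localRouting_of_memXiFamily` ∕ S5's road γ, token for token) — so ★ `clFinChoice P v` is in branch 1 a.e. [§13.3 p. 201 «`π_v = π_v⁰` for almost all `v`»].
* §2 `clFinChoice_eq_recordπn_of_memXiFamily_of_anisotropic` — for `P` in the ξ-envelope (`MemXiFamily`): a.e. `clFinChoice P v` is a spherical admissible unitarizable constituent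
  and EQUALS the record's `πⁿ(ξ_v)` (★ `xiFamilyOfRecord`).
* §3 `evpString_of_memXiFamily_of_anisotropic` — **THE E1 STRING** (text (ii) of ★ p861517 `R90.S5.evp_eq_record_of_ae_routesAt`, read at `H`; = p06's ‹E1 STRING› binder
  token for token): `∃ S₀, ∀ S ⊇ ↑S₀, ∀ hP hξ, evpAtIntegralLevel L 3 H (clFinChoice P ·) S hP = evpAtIntegralLevel L 3 H ((xiFamilyOfRecord … ξ ·).πn) S hξ` — print's
  «`t_{S′}(π′) = t_{S′}(Π(ξ))`» [(14.6.2) p. 241; Thm. 14.6.4 proof l. 1 p. 243].  With §3, p06's pin reads `hstring := fun _ => evpString_of_memXiFamily_of_anisotropic …` at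
  every instance of (AE-ⅱ) ((B4)'s prefix carries `hanis`, `hμω`, `MemXiFamily`).
* §4 `evpString_with_supply_of_memXiFamily_of_anisotropic` — the same with the a.e. spherical-and-equal supply conjunct kept (S5's full (γ-evp) text), for consumers that
  need the sphericity witnesses `hP`, `hξ` off `S₀`.
[cite: Rogawski1990, §13.3 p. 201; §13.6 pp. 209–210; §14.5 p. 237; §14.6 (14.6.2) p. 241, Thm. 14.6.4 p. 243] [cite: FlathCorvallis1979, Thm. 3] [cite: Godement1964, Exp. 257 Thm. 4.2]
[cite: CartierCorvallis1979, §IV.1 Cor. 4.1]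
-/

set_option autoImplicit false
-- the mandated namespace repeats `HodgeConjecture.HodgeConjecture`, as in every `Theorems/*.lean` of this sub-problem
set_option linter.dupNamespace false

noncomputable section

open NumberField IsDedekindDomain MeasureTheory Filter
open scoped Matrix ComplexOrder

open Literature.NumberTheory Literature.NumberTheory.Automorphic Literature.NumberTheory.Automorphic.UnitaryGroup
open Literature.NumberTheory.GaloisRepresentations
open Literature.NumberTheory.Rogawski1990
open Summit.HodgeConjecture.HodgeConjecture.Cruxes.H413
open Summit.HodgeConjecture.HodgeConjecture.Cruxes.H413.F0P3ClassTokenChoice (clFinChoice admUnitConstituents)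
open Summit.HodgeConjecture.HodgeConjecture.Cruxes.H413.F0P3XiLocalFamilyOfRecord (xiFamilyOfRecord)
open Summit.HodgeConjecture.HodgeConjecture.Cruxes.H413.K2E1EvpOfAutomorphicClass (evpAtIntegralLevel)

namespace Summit.HodgeConjecture.HodgeConjecture.R90.S9

variable (L : Type) [Field L] [NumberField L] [IsCMField L] (H : Matrix (Fin 3) (Fin 3) L)

/-! ## §1 The cofinite spherical supply at an anisotropic form -/

/-- **`hsph` AT AN ANISOTROPIC `H`, UNCONDITIONALLY** — every discrete automorphic `P` of `U(H)`, `H` anisotropic, has at all but finitely many finite places `v` of `L⁺` a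
`U(H)(𝒪_v)`-spherical admissible unitarizable constituent (★ `admUnitConstituents`): «AFA» holds at `H` (★ `automorphicFlathAdmissible_of_anisotropic`: compact quotient) and S5's ★
`hsph_of_automorphicFlathAdmissible` does the rest.  No sorry. [cite: Rogawski1990, §13.3 p. 201; §14.5 p. 237] [cite: FlathCorvallis1979, Thm. 3] [cite: Godement1964, Exp. 257 Thm. 4.2] -/
theorem hsph_of_anisotropic
    (hanis : ∀ x : Fin 3 → L, Literature.AlgebraicGeometry.ShimuraVarieties.hermForm (cmConjRingHom L) H x x = 0 → x = 0)
    (μA : Measure (adelicGroupData (↥(maximalRealSubfield L)) L (IsCMField.complexConj L) 3 H).automorphicQuotient)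
    [(adelicGroupData (↥(maximalRealSubfield L)) L (IsCMField.complexConj L) 3 H).IsAutomorphicMeasure μA]
    (P : DiscreteAutomorphicRep (adelicGroupData (↥(maximalRealSubfield L)) L (IsCMField.complexConj L) 3 H) μA) :
    ∀ᶠ v : HeightOneSpectrum (𝓞 ↥(maximalRealSubfield L)) in cofinite,
      ∃ c ∈ admUnitConstituents P v, c.IsSpherical (cmLocalIntegralLevel L 3 H v) :=
  R90.S5.hsph_of_automorphicFlathAdmissible L H μA (automorphicFlathAdmissible_of_anisotropic L 3 H hanis μA) P

/-! ## §2 The chosen classes ARE the record ξ-string, a.e. -/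

/-- **(γ-cls) AT AN ANISOTROPIC `H`** — for every discrete `P` of `U(H)` in the ξ-envelope (★ `MemXiFamily`), `H` anisotropic: at all but finitely many finite places `v` the chosen
class ★ `clFinChoice P v` is a spherical admissible unitarizable constituent of `P` and EQUALS the record's `πⁿ(ξ_v)` (★ `xiFamilyOfRecord … ξ v`).  S5's ★
`xiString_eventually_clFinChoice_eq_recordπn_of_automorphicFlathAdmissible` at ★ «AFA» for anisotropic `H`.  No sorry.
[cite: Rogawski1990, §13.3 p. 201; §13.1 p. 199; §12.2 (2) pp. 173–174] [cite: FlathCorvallis1979, Thm. 3] -/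
theorem clFinChoice_eq_recordπn_of_memXiFamily_of_anisotropic
    (hH : (H.map (cmConjRingHom L))ᵀ = H) (hHd : IsUnit H.det)
    (hanis : ∀ x : Fin 3 → L, Literature.AlgebraicGeometry.ShimuraVarieties.hermForm (cmConjRingHom L) H x x = 0 → x = 0)
    (μω : HeckeCharacter L) (hμu : μω.IsUnitary)
    (hμω : ∀ x : Literature.NumberTheory.GaloisRepresentations.ideleGroup ↥(maximalRealSubfield L),
      μω (AdeleRing.ideleBaseChange (↥(maximalRealSubfield L)) L x) = quadraticHeckeCharCM L x)
    (ξ : OneDimAutRepH L)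
    (μA : Measure (adelicGroupData (↥(maximalRealSubfield L)) L (IsCMField.complexConj L) 3 H).automorphicQuotient)
    [(adelicGroupData (↥(maximalRealSubfield L)) L (IsCMField.complexConj L) 3 H).IsAutomorphicMeasure μA]
    (P : DiscreteAutomorphicRep (adelicGroupData (↥(maximalRealSubfield L)) L (IsCMField.complexConj L) 3 H) μA)
    (hmem : MemXiFamily P hH hHd μω hμu ξ) :
    ∀ᶠ v : HeightOneSpectrum (𝓞 ↥(maximalRealSubfield L)) in cofinite,
      clFinChoice P v ∈ admUnitConstituents P v ∧ (clFinChoice P v).IsSpherical (cmLocalIntegralLevel L 3 H v) ∧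
        clFinChoice P v = (xiFamilyOfRecord L H hH hHd μω hμu ξ v).πn :=
  R90.S5.xiString_eventually_clFinChoice_eq_recordπn_of_automorphicFlathAdmissible L H μA (automorphicFlathAdmissible_of_anisotropic L 3 H hanis μA)
    hH hHd μω hμu hμω P ξ hmem

/-! ## §3 The E1 string (p06's `hstring`, discharged) -/

/-- **THE E.V.P. STRING «`t(P) = t(Π(ξ))`» FOR THE DEFINITE INNER FORM, UNCONDITIONALLY** — for every CM `L`, every ANISOTROPIC hermitian `H ∈ M₃(L)` with unit determinant,
every `ξ` and every discrete `P` of `U(H)` in the ξ-envelope (`MemXiFamily`): there is a finite set `S₀` of finite places of `L⁺` such that for EVERY `S ⊇ S₀` and all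
sphericity witnesses the E1 eigenvalue packages at the integral levels coincide,
`evpAtIntegralLevel L 3 H (clFinChoice P ·) S hP = evpAtIntegralLevel L 3 H ((xiFamilyOfRecord … ξ ·).πn) S hξ` — the text (ii) of ★ `R90.S5.evp_eq_record_of_ae_routesAt` read
at `H`, token for token (= the ‹E1 STRING› binder of R90-IF-p06's (AE-ⅱ) engine).  S5's ★ (γ-evp) under «AFA» + ★ «AFA» at anisotropic `H`.  No sorry; axioms TRIO.
[cite: Rogawski1990, §14.6 (14.6.2) p. 241, Thm. 14.6.4 p. 243; §13.6 pp. 209–210; §14.5 p. 237] [cite: FlathCorvallis1979, Thm. 3] [cite: CartierCorvallis1979, §IV.1 Cor. 4.1] -/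
theorem evpString_of_memXiFamily_of_anisotropic
    (hH : (H.map (cmConjRingHom L))ᵀ = H) (hHd : IsUnit H.det)
    (hanis : ∀ x : Fin 3 → L, Literature.AlgebraicGeometry.ShimuraVarieties.hermForm (cmConjRingHom L) H x x = 0 → x = 0)
    (μω : HeckeCharacter L) (hμu : μω.IsUnitary)
    (hμω : ∀ x : Literature.NumberTheory.GaloisRepresentations.ideleGroup ↥(maximalRealSubfield L),
      μω (AdeleRing.ideleBaseChange (↥(maximalRealSubfield L)) L x) = quadraticHeckeCharCM L x)
    (ξ : OneDimAutRepH L)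
    (μA : Measure (adelicGroupData (↥(maximalRealSubfield L)) L (IsCMField.complexConj L) 3 H).automorphicQuotient)
    [(adelicGroupData (↥(maximalRealSubfield L)) L (IsCMField.complexConj L) 3 H).IsAutomorphicMeasure μA]
    (P : DiscreteAutomorphicRep (adelicGroupData (↥(maximalRealSubfield L)) L (IsCMField.complexConj L) 3 H) μA)
    (hmem : MemXiFamily P hH hHd μω hμu ξ) :
    ∃ S₀ : Finset (HeightOneSpectrum (𝓞 ↥(maximalRealSubfield L))),
      ∀ (S : Set (HeightOneSpectrum (𝓞 ↥(maximalRealSubfield L)))), (↑S₀ : Set _) ⊆ S →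
        ∀ (hP : ∀ v, v ∉ S → (clFinChoice P v).IsSpherical (cmLocalIntegralLevel L 3 H v))
          (hξ : ∀ v, v ∉ S → (xiFamilyOfRecord L H hH hHd μω hμu ξ v).πn.IsSpherical (cmLocalIntegralLevel L 3 H v)),
          evpAtIntegralLevel L 3 H (fun v => clFinChoice P v) S hP =
            evpAtIntegralLevel L 3 H (fun v => (xiFamilyOfRecord L H hH hHd μω hμu ξ v).πn) S hξ := by
  obtain ⟨S₀, -, h⟩ := R90.S5.xiString_exists_finset_evpAtIntegralLevel_eq_of_automorphicFlathAdmissible L H μA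
    (automorphicFlathAdmissible_of_anisotropic L 3 H hanis μA) hH hHd μω hμu hμω P ξ hmem
  exact ⟨S₀, h⟩

/-! ## §4 The E1 string with its a.e. supply -/

/-- **THE E.V.P. STRING WITH ITS SUPPLY** — as §3, keeping S5's first conjunct: off `S₀` the chosen classes of `P` and the record's `πⁿ(ξ_v)` are `U(H)(𝒪_v)`-spherical and EQUAL
(so the witnesses `hP`, `hξ` exist for every `S ⊇ S₀`).  No sorry. [cite: Rogawski1990, §13.6 pp. 209–210; §14.6 (14.6.2) p. 241] [cite: FlathCorvallis1979, Thm. 3] -/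
theorem evpString_with_supply_of_memXiFamily_of_anisotropic
    (hH : (H.map (cmConjRingHom L))ᵀ = H) (hHd : IsUnit H.det)
    (hanis : ∀ x : Fin 3 → L, Literature.AlgebraicGeometry.ShimuraVarieties.hermForm (cmConjRingHom L) H x x = 0 → x = 0)
    (μω : HeckeCharacter L) (hμu : μω.IsUnitary)
    (hμω : ∀ x : Literature.NumberTheory.GaloisRepresentations.ideleGroup ↥(maximalRealSubfield L),
      μω (AdeleRing.ideleBaseChange (↥(maximalRealSubfield L)) L x) = quadraticHeckeCharCM L x)
    (ξ : OneDimAutRepH L)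
    (μA : Measure (adelicGroupData (↥(maximalRealSubfield L)) L (IsCMField.complexConj L) 3 H).automorphicQuotient)
    [(adelicGroupData (↥(maximalRealSubfield L)) L (IsCMField.complexConj L) 3 H).IsAutomorphicMeasure μA]
    (P : DiscreteAutomorphicRep (adelicGroupData (↥(maximalRealSubfield L)) L (IsCMField.complexConj L) 3 H) μA)
    (hmem : MemXiFamily P hH hHd μω hμu ξ) :
    ∃ S₀ : Finset (HeightOneSpectrum (𝓞 ↥(maximalRealSubfield L))),
      (∀ v : HeightOneSpectrum (𝓞 ↥(maximalRealSubfield L)), v ∉ S₀ →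
        (clFinChoice P v).IsSpherical (cmLocalIntegralLevel L 3 H v) ∧
          (xiFamilyOfRecord L H hH hHd μω hμu ξ v).πn.IsSpherical (cmLocalIntegralLevel L 3 H v) ∧
          clFinChoice P v = (xiFamilyOfRecord L H hH hHd μω hμu ξ v).πn) ∧
      ∀ (S : Set (HeightOneSpectrum (𝓞 ↥(maximalRealSubfield L)))), (↑S₀ : Set _) ⊆ S →
        ∀ (hP : ∀ v, v ∉ S → (clFinChoice P v).IsSpherical (cmLocalIntegralLevel L 3 H v))
          (hξ : ∀ v, v ∉ S → (xiFamilyOfRecord L H hH hHd μω hμu ξ v).πn.IsSpherical (cmLocalIntegralLevel L 3 H v)),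
          evpAtIntegralLevel L 3 H (fun v => clFinChoice P v) S hP =
            evpAtIntegralLevel L 3 H (fun v => (xiFamilyOfRecord L H hH hHd μω hμu ξ v).πn) S hξ :=
  R90.S5.xiString_exists_finset_evpAtIntegralLevel_eq_of_automorphicFlathAdmissible L H μA (automorphicFlathAdmissible_of_anisotropic L 3 H hanis μA)
    hH hHd μω hμu hμω P ξ hmem

end Summit.HodgeConjecture.HodgeConjecture.R90.S9

end
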